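import Summits.BirchSwinnertonDyer.Rank1Residual.Additive.KatoDescentRankOneCountOfH2Count
import Summits.BirchSwinnertonDyer.BirchSwinnertonDyer.Theorems.BiquadraticEisensteinDescentDeuringOfCoreLocal
import HarnessLib

set_option autoImplicit false

/-!
# COUNT-H2 and COUNT-EC⁰ ON THE CM ROWS: the all-additive binder of Part 32 DISCHARGED from `W.HasCM`
# (seat `bsd-cm-prr-ty1` g13, cell `bsd-cm`; theorems only: no definition, no named fact, no instance, no `sorry`)

Part 33 of the seat's kernel cut of stub 3 `stub_rankOneCountReadingKato` of the Kato–Perrin-Riou skeletons v4 (cruxes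
stmt-BirchSwinnertonDyer-19945 / -19223); successor row (s2) of planner D535 (2).  Part 32
(`KatoDescentRankOneCountOfH2Count`) compares the H²-side count `Kato2004.KatoH2CountAt W p #(𝐇²_Γ)` ((14.14.2) + (14.9.3))
with the counting display of stub 3 on the ALL-ADDITIVE rows, i.e. under the binder «every bad `ℓ ≠ p` of `W` is additive»
(`∀ v ∈ W.badPlaces (𝓞 ℚ), ℓ_v ≠ p → W.HasAdditiveReductionAt v`).  Both deciding cruxes of the cell are CM rows
(`X12.CMRamifiedSeven`: the class 𝒞₇ of twists of `49a1`; `X12.CMInertBad`: binder `W.HasCM`), and a CM elliptic curve over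
`ℚ` has no multiplicative prime (`j(E) ∈ ℤ`; tree `hasAdditiveReductionAt_of_hasCM_of_bad`, route BED file L).  THIS FILE
re-keys Part 32 by `W.HasCM`:
* §1 `forall_badPlaces_hasAdditiveReductionAt_of_hasCM` — `W.HasCM` ⟹ the all-additive binder (`mem_badPlaces_iff` is
  `Iff.rfl`); `exists_finset_badPlaces_ne_of_hasCM` — the finite set `Σ` of bad places `≠ v_p` with Part 31b's three side
  conditions.
* §2 ON THE CM ROWS, `Σ` built inside (no `Q`/`hQp`/`hQadd`/`hQbad` binders):
  `finite_katoStrictSelmer_and_padicValNat_card_eq_of_hasCM` (Part 31b: `Sel_str` finite and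
  `v_p #Sel_str + v_p #W(ℚ_p)[p^∞] + a = v_p #Ш[p^∞] + v_p Tam + v(log_ω P)`), `padicValNat_add_eq_of_katoH2CountAt_of_hasCM`
  and `katoH2CountAt_iff_padicValNat_add_eq_of_hasCM` (Part 32 §2: `KatoH2CountAt W p n → v_p n + a = v_p #Ш[p^∞] + v_p Tam +
  v(log_ω P)`, and `↔` for `n = p^k`).
* §3 the displays **COUNT-H2|CM** and **COUNT-EC⁰|CM** = Part 32's COUNT-H2 and E9's COUNT-EC⁰ with `W.HasCM →` in the slot
  of the all-additive binder (same position, every other binder byte-identical), and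
  `countH2_cm_of_countH2_additive` (COUNT-H2|add ⟹ COUNT-H2|CM), `countEC₀_cm_of_countEC₀` (COUNT-EC⁰ ⟹ COUNT-EC⁰|CM),
  **`countEC₀_cm_of_gzk_of_countH2_cm`** ({GZK} + COUNT-H2|CM ⟹ COUNT-EC⁰|CM),
  **`countH2_cm_of_gzk_of_thm12_4_of_countEC₀_cm`** ({GZK, `thm12_4`} + COUNT-EC⁰|CM ⟹ COUNT-H2|CM),
  `countH2_cm_of_gzk_of_thm12_4_of_countEC₀` (from the display of record's companion COUNT-EC⁰ itself).
So, modulo {GZK, `thm12_4`}, COUNT-H2|CM ⟺ COUNT-EC⁰|CM, and both follow from the displays of record (COUNT-FINE⁰ ⟹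
COUNT-EC⁰, E9; COUNT-H2|add, Part 32) — the form the cell's CM rows consume.
HONEST LABEL: theorems only; no stub or item is closed; nothing is registered; nothing is asserted on 19945 / 19223;
Kato's Main Conjecture and Perrin-Riou's conjecture are not touched; BSD is not proved for any curve.  References:
[Kato2004Asterisque] Thm. 12.4 (p. 221), (14.9.3) (p. 240), §14.14 (p. 243), Lemma 14.15, Prop. 14.16 (p. 244);
[SilvermanATAEC1994] Thm. II.6.4 and proof of Thm. II.10.5 (p. 172); [GreenbergLNM1716] §2–§4; [BlochKato1990] Ex. 3.11;
[GrossZagier1986] Thm. I.7.3; [SilvermanAEC2009] VII.5 Prop. 5.1, VIII.1 Rem. 1.3.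
-/

noncomputable section

open scoped Classical NumberField ContRepresentation

open WeierstrassCurve Field IsDedekindDomain NumberField CategoryTheory Literature.NumberTheory.EllipticCurves
  Literature.NumberTheory.EllipticCurves.Kato2004 Literature.NumberTheory.GaloisRepresentations
  Literature.NumberTheory.GaloisRepresentations.DiscreteGaloisModule Literature.NumberTheory.EllipticCurves.Kato2004.EulerSystemValues
  Literature.NumberTheory.EllipticCurves.IwasawaAlgebra Literature.NumberTheory.EllipticCurves.Rank1Residual
open WeierstrassCurve (galH1Primary kummerMapTorsion)
open Summit.BirchSwinnertonDyer.Rank1Residual.X12.O11 Summit.BirchSwinnertonDyer.Rank1Residual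
  Summit.BirchSwinnertonDyer.Rank1Residual.Additive.GlobalKummer
  Summit.BirchSwinnertonDyer.BirchSwinnertonDyer.Theorems.CongruentShaFreeCutKatoKummerLogTorsion
  Summit.BirchSwinnertonDyer.BirchSwinnertonDyer.Theorems.BiquadraticEisensteinDescentDeuringOfCore

namespace Summit.BirchSwinnertonDyer.Rank1Residual.Additive.StrictCount

/-! ## §1 `W.HasCM` ⟹ every bad `ℓ ≠ p` is additive; the set `Σ` on a CM row -/

section CM

variable (W : WeierstrassCurve ℚ) [W.IsElliptic] (p : ℕ)

/-- **A CM curve over `ℚ` satisfies the all-additive binder of Parts 30–32**: every bad place is additive (no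
multiplicative prime since `j(E) ∈ ℤ`; tree `hasAdditiveReductionAt_of_hasCM_of_bad`), a fortiori every bad `ℓ ≠ p`.
[cite: SilvermanATAEC1994, Thm. II.6.4 and proof of Thm. II.10.5 (p. 172)] -/
theorem forall_badPlaces_hasAdditiveReductionAt_of_hasCM (hCM : W.HasCM) :
    ∀ v ∈ W.badPlaces (𝓞 ℚ), ((Rat.HeightOneSpectrum.primesEquiv v : Nat.Primes) : ℕ) ≠ p →
      W.HasAdditiveReductionAt v :=
  fun v hv _ => hasAdditiveReductionAt_of_hasCM_of_bad W hCM v ((mem_badPlaces_iff W v).mp hv)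

/-- **The finite set `Σ` of bad places `≠ v_p` on a CM row**, with the three side conditions `hQp`, `hQadd`, `hQbad` of
Part 31b (Part 32 §1 `exists_finset_badPlaces_ne` fed by `forall_badPlaces_hasAdditiveReductionAt_of_hasCM`).
[cite: SilvermanAEC2009, VIII.1 Remark 1.3] [cite: SilvermanATAEC1994, proof of Thm. II.10.5 (p. 172)] -/
theorem exists_finset_badPlaces_ne_of_hasCM (hCM : W.HasCM) :
    ∃ Q : Finset (HeightOneSpectrum (𝓞 ℚ)),
      (∀ v ∈ Q, ((Rat.HeightOneSpectrum.primesEquiv v : Nat.Primes) : ℕ) ≠ p) ∧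
      (∀ v ∈ Q, W.HasAdditiveReductionAt v) ∧
      (∀ v : HeightOneSpectrum (𝓞 ℚ), v ∈ W.badPlaces (𝓞 ℚ) →
        ((Rat.HeightOneSpectrum.primesEquiv v : Nat.Primes) : ℕ) ≠ p → v ∈ Q) :=
  exists_finset_badPlaces_ne W p (forall_badPlaces_hasAdditiveReductionAt_of_hasCM W p hCM)

end CM

/-! ## §2 ON THE CM ROWS: the strict Selmer count and `KatoH2CountAt ⟷ v_p n + a = …`, `Σ` built inside -/

section Rows

variable (W : WeierstrassCurve ℚ) [W.IsElliptic] [W.IsGloballyMinimal] (p : ℕ) [hp : Fact p.Prime]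
  [ContinuousSMul ℤ_[p] (W.tateModule p)]

/-- **Part 31b ON THE CM ROWS**: for `W/ℚ` globally minimal WITH CM, `p` odd, `Addv W p`, rank one generated by `P` modulo
torsion, `Ш[p^∞]` finite, `p ∤ #W(ℚ)_tors`, `x = κ_∞(P)` and `H¹(ℤ[1/p],T_pW) = ℤ_p ∙ p^a x`: `Sel_str = katoStrictSelmer W p {v_p}`
is finite and `v_p #Sel_str + v_p #W(ℚ_p)[p^∞] + a = v_p #Ш[p^∞] + v_p Tam + v(log_ω P)` (`Σ` = the bad places `≠ v_p`, all
additive by §1). [cite: Kato2004Asterisque, (14.9.3) (p. 240), Prop. 14.16 (p. 244)] [cite: SilvermanATAEC1994, proof of Thm. II.10.5 (p. 172)] -/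
theorem finite_katoStrictSelmer_and_padicValNat_card_eq_of_hasCM (hCM : W.HasCM) (hodd : p ≠ 2) (hadd : Addv W p)
    (hrank : W.mordellWeilRank = 1) (hsha : Finite (AddCommGroup.primaryComponent W.sha p))
    (htors : ¬ p ∣ W.torsionOrder) {P : W.toAffine.Point}
    (hgen : ∀ R : W.toAffine.Point, ∃ n : ℤ, IsOfFinAddOrder (R - n • P)) {x : H1 (tateRep W p) ⊤}
    (hx : ∀ j : ℕ,
      (ofTopSubgroup (W.torsionGaloisModule ((p : ℤ) ^ j)).toTopRep 1).hom (reduceH1Pk W p j ⊤ x) =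
        kummerMapTorsion W ((p : ℤ) ^ j) (zsmul_pow_surjective W p j) P)
    {a : ℕ} (ha : integralH1 (tateRep W p) p ⊤ = ℤ_[p] ∙ (p ^ a • x)) :
    Finite (katoStrictSelmer W p {primePlace p}) ∧
      (padicValNat p (Nat.card (katoStrictSelmer W p {primePlace p})) : ℤ) +
          padicValNat p (Nat.card (AddCommGroup.primaryComponent
            (W.baseChange ((primePlace p).adicCompletion ℚ)).toAffine.Point p)) + a =
        padicValNat p (Nat.card (AddCommGroup.primaryComponent W.sha p)) + padicValNat p W.tamagawaProduct +
          (padicLogLocal W p (Affine.Point.map (W' := W.toAffine) (S := ℚ) (Algebra.ofId ℚ ℚ_[p]) P)).valuation := by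
  obtain ⟨Q, hQp, hQadd, hQbad⟩ := exists_finset_badPlaces_ne_of_hasCM W p hCM
  exact finite_katoStrictSelmer_and_padicValNat_card_eq W p hodd hadd hrank hsha htors hgen hx Q hQp hQadd hQbad ha

/-- **Part 32 §2 (→) ON THE CM ROWS**: `KatoH2CountAt W p n` ⟹ `v_p n + a = v_p #Ш[p^∞] + v_p Tam + v(log_ω P)` (same
hypotheses; `Σ` built inside). [cite: Kato2004Asterisque, (14.9.3) (p. 240), (14.14.2) (p. 243), Prop. 14.16 (p. 244)]
[cite: SilvermanATAEC1994, proof of Thm. II.10.5 (p. 172)] -/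
theorem padicValNat_add_eq_of_katoH2CountAt_of_hasCM (hCM : W.HasCM) (hodd : p ≠ 2) (hadd : Addv W p)
    (hrank : W.mordellWeilRank = 1) (hsha : Finite (AddCommGroup.primaryComponent W.sha p))
    (htors : ¬ p ∣ W.torsionOrder) {P : W.toAffine.Point}
    (hgen : ∀ R : W.toAffine.Point, ∃ n : ℤ, IsOfFinAddOrder (R - n • P)) {x : H1 (tateRep W p) ⊤}
    (hx : ∀ j : ℕ,
      (ofTopSubgroup (W.torsionGaloisModule ((p : ℤ) ^ j)).toTopRep 1).hom (reduceH1Pk W p j ⊤ x) =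
        kummerMapTorsion W ((p : ℤ) ^ j) (zsmul_pow_surjective W p j) P)
    {a : ℕ} (ha : integralH1 (tateRep W p) p ⊤ = ℤ_[p] ∙ (p ^ a • x)) {n : ℕ} (hn : KatoH2CountAt W p n) :
    (padicValNat p n : ℤ) + a =
      padicValNat p (Nat.card (AddCommGroup.primaryComponent W.sha p)) + padicValNat p W.tamagawaProduct +
        (padicLogLocal W p (Affine.Point.map (W' := W.toAffine) (S := ℚ) (Algebra.ofId ℚ ℚ_[p]) P)).valuation := by
  obtain ⟨Q, hQp, hQadd, hQbad⟩ := exists_finset_badPlaces_ne_of_hasCM W p hCM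
  exact padicValNat_add_eq_of_katoH2CountAt W p hodd hadd hrank hsha htors hgen hx Q hQp hQadd hQbad ha hn

/-- **Part 32 §2 ON THE CM ROWS**: for `n` a power of `p`, `KatoH2CountAt W p n ↔ v_p n + a = v_p #Ш[p^∞] + v_p Tam +
v(log_ω P)` (same hypotheses; `Σ` built inside). [cite: Kato2004Asterisque, (14.9.3) (p. 240), (14.14.2) (p. 243), Prop. 14.16 (p. 244)]
[cite: SilvermanATAEC1994, proof of Thm. II.10.5 (p. 172)] -/
theorem katoH2CountAt_iff_padicValNat_add_eq_of_hasCM (hCM : W.HasCM) (hodd : p ≠ 2) (hadd : Addv W p)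
    (hrank : W.mordellWeilRank = 1) (hsha : Finite (AddCommGroup.primaryComponent W.sha p))
    (htors : ¬ p ∣ W.torsionOrder) {P : W.toAffine.Point}
    (hgen : ∀ R : W.toAffine.Point, ∃ n : ℤ, IsOfFinAddOrder (R - n • P)) {x : H1 (tateRep W p) ⊤}
    (hx : ∀ j : ℕ,
      (ofTopSubgroup (W.torsionGaloisModule ((p : ℤ) ^ j)).toTopRep 1).hom (reduceH1Pk W p j ⊤ x) =
        kummerMapTorsion W ((p : ℤ) ^ j) (zsmul_pow_surjective W p j) P)
    {a : ℕ} (ha : integralH1 (tateRep W p) p ⊤ = ℤ_[p] ∙ (p ^ a • x)) {n : ℕ} (hn : ∃ k : ℕ, n = p ^ k) :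
    KatoH2CountAt W p n ↔
      (padicValNat p n : ℤ) + a =
        padicValNat p (Nat.card (AddCommGroup.primaryComponent W.sha p)) + padicValNat p W.tamagawaProduct +
          (padicLogLocal W p (Affine.Point.map (W' := W.toAffine) (S := ℚ) (Algebra.ofId ℚ ℚ_[p]) P)).valuation := by
  obtain ⟨Q, hQp, hQadd, hQbad⟩ := exists_finset_badPlaces_ne_of_hasCM W p hCM
  exact katoH2CountAt_iff_padicValNat_add_eq W p hodd hadd hrank hsha htors hgen hx Q hQp hQadd hQbad ha hn

end Rows

/-! ## §3 The displays COUNT-H2|CM and COUNT-EC⁰|CM: each implies the other modulo {GZK, `thm12_4`} -/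

section Displays

open Summit.BirchSwinnertonDyer.Rank1Residual.Additive.LocPKummer

/-- **COUNT-H2|add ⟹ COUNT-H2|CM.**  COUNT-H2|CM (the conclusion) is Part 32's display COUNT-H2 with the binder «every bad
`ℓ ≠ p` additive» REPLACED, in the same slot, by `W.HasCM`; it follows from COUNT-H2 by §1.
[cite: Kato2004Asterisque, (14.9.3) (p. 240) and (14.14.2) (p. 243)] [cite: SilvermanATAEC1994, proof of Thm. II.10.5 (p. 172)] -/
theorem countH2_cm_of_countH2_additive
    (hH2 : ∀ (W : WeierstrassCurve ℚ) [W.IsElliptic] [W.IsGloballyMinimal] (p : ℕ) [Fact p.Prime],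
      letI : ContinuousSMul ℤ_[p] (W.tateModule p) := TateModule.continuousSMul_padicInt
      ∀ (κ : ZpExtension ℚ p) (γ : absoluteGaloisGroup ℚ), κ.IsCyclotomic → κ.IsTopGenerator γ →
        ∀ (I : IwasawaH1Data W p κ γ) (J : IwasawaH2Data W p κ γ I),
          W.analyticRank = 1 → p ≠ 2 → Addv W p → 0 ≤ padicValRat p W.j → ¬ p ∣ W.torsionOrder → Finite W.sha →
          (∀ v ∈ W.badPlaces (𝓞 ℚ), ((Rat.HeightOneSpectrum.primesEquiv v : Nat.Primes) : ℕ) ≠ p →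
            W.HasAdditiveReductionAt v) →
          (∀ (Y : W.FineSelmerDualData κ γ⁻¹) (𝔮 : PrimeSpectrum (IwasawaAlgebra p)), 𝔮.asIdeal.height = 1 →
            Module.lengthAt (IwasawaAlgebra p) J.H2 𝔮 = Module.lengthAt (IwasawaAlgebra p) Y.X 𝔮) →
          KatoH2CountAt W p (Nat.card (coinvariants p J.H2))) :
    ∀ (W : WeierstrassCurve ℚ) [W.IsElliptic] [W.IsGloballyMinimal] (p : ℕ) [Fact p.Prime],
      letI : ContinuousSMul ℤ_[p] (W.tateModule p) := TateModule.continuousSMul_padicInt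
      ∀ (κ : ZpExtension ℚ p) (γ : absoluteGaloisGroup ℚ), κ.IsCyclotomic → κ.IsTopGenerator γ →
        ∀ (I : IwasawaH1Data W p κ γ) (J : IwasawaH2Data W p κ γ I),
          W.analyticRank = 1 → p ≠ 2 → Addv W p → 0 ≤ padicValRat p W.j → ¬ p ∣ W.torsionOrder → Finite W.sha →
          W.HasCM →
          (∀ (Y : W.FineSelmerDualData κ γ⁻¹) (𝔮 : PrimeSpectrum (IwasawaAlgebra p)), 𝔮.asIdeal.height = 1 →
            Module.lengthAt (IwasawaAlgebra p) J.H2 𝔮 = Module.lengthAt (IwasawaAlgebra p) Y.X 𝔮) →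
          KatoH2CountAt W p (Nat.card (coinvariants p J.H2)) := by
  intro W _ _ p _
  letI : ContinuousSMul ℤ_[p] (W.tateModule p) := TateModule.continuousSMul_padicInt
  intro κ γ hκ hγ I J hr hp2 hadd hj htors hsha hCM hpin
  exact hH2 W p κ γ hκ hγ I J hr hp2 hadd hj htors hsha (forall_badPlaces_hasAdditiveReductionAt_of_hasCM W p hCM) hpin

/-- **COUNT-EC⁰ ⟹ COUNT-EC⁰|CM.**  COUNT-EC⁰|CM (the conclusion) is E9's display COUNT-EC⁰ («`v_p #(J.H2)_Γ + v₀ = v_p #Ш[p^∞]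
+ v_p Tam + 2·v_p log_ω P`», the companion of the display of record COUNT-FINE⁰) with the extra binder `W.HasCM` in the slot
where Part 32 put «every bad `ℓ ≠ p` additive»; dropping a hypothesis. [cite: Kato2004Asterisque, §14.14 (p. 243), Prop. 14.16 (p. 244)] -/
theorem countEC₀_cm_of_countEC₀
    (hEC : ∀ (W : WeierstrassCurve ℚ) [W.IsElliptic] [W.IsGloballyMinimal] (p : ℕ) [Fact p.Prime],
      letI : ContinuousSMul ℤ_[p] (W.tateModule p) := TateModule.continuousSMul_padicInt
      ∀ (κ : ZpExtension ℚ p) (γ : absoluteGaloisGroup ℚ), κ.IsCyclotomic → κ.IsTopGenerator γ →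
        ∀ (I : IwasawaH1Data W p κ γ) (J : IwasawaH2Data W p κ γ I) (P : W.toAffine.Point)
          (φ : integralH1 (tateRep W p) p (κ.layerSubgroup 0) →ₗ[ℤ_[p]] ℚ_[p]) (v₀ : ℤ),
          W.analyticRank = 1 → p ≠ 2 → Addv W p → 0 ≤ padicValRat p W.j → ¬ p ∣ W.torsionOrder →
          Finite W.sha →
          (∀ (Y : W.FineSelmerDualData κ γ⁻¹) (𝔮 : PrimeSpectrum (IwasawaAlgebra p)), 𝔮.asIdeal.height = 1 →
            Module.lengthAt (IwasawaAlgebra p) J.H2 𝔮 = Module.lengthAt (IwasawaAlgebra p) Y.X 𝔮) →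
          (∀ Q : W.toAffine.Point, ∃ n : ℤ, IsOfFinAddOrder (Q - n • P)) →
          (∀ x : integralH1 (tateRep W p) p (κ.layerSubgroup 0),
            HasLocPKummerLog W p (layerZeroToTop W p κ (x : H1 (tateRep W p) (κ.layerSubgroup 0))) (φ x)) →
          LinearMap.range φ = Submodule.span ℤ_[p] {((p : ℚ_[p]) ^ v₀)} →
          (padicValNat p (Nat.card (coinvariants p J.H2)) : ℤ) + v₀ =
            padicValNat p (Nat.card (AddCommGroup.primaryComponent W.sha p)) + padicValNat p W.tamagawaProduct +
              2 * (padicLogLocal W p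
                (WeierstrassCurve.Affine.Point.map (W' := W.toAffine) (S := ℚ) (Algebra.ofId ℚ ℚ_[p]) P)).valuation) :
    ∀ (W : WeierstrassCurve ℚ) [W.IsElliptic] [W.IsGloballyMinimal] (p : ℕ) [Fact p.Prime],
      letI : ContinuousSMul ℤ_[p] (W.tateModule p) := TateModule.continuousSMul_padicInt
      ∀ (κ : ZpExtension ℚ p) (γ : absoluteGaloisGroup ℚ), κ.IsCyclotomic → κ.IsTopGenerator γ →
        ∀ (I : IwasawaH1Data W p κ γ) (J : IwasawaH2Data W p κ γ I) (P : W.toAffine.Point)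
          (φ : integralH1 (tateRep W p) p (κ.layerSubgroup 0) →ₗ[ℤ_[p]] ℚ_[p]) (v₀ : ℤ),
          W.analyticRank = 1 → p ≠ 2 → Addv W p → 0 ≤ padicValRat p W.j → ¬ p ∣ W.torsionOrder →
          Finite W.sha →
          W.HasCM →
          (∀ (Y : W.FineSelmerDualData κ γ⁻¹) (𝔮 : PrimeSpectrum (IwasawaAlgebra p)), 𝔮.asIdeal.height = 1 →
            Module.lengthAt (IwasawaAlgebra p) J.H2 𝔮 = Module.lengthAt (IwasawaAlgebra p) Y.X 𝔮) →
          (∀ Q : W.toAffine.Point, ∃ n : ℤ, IsOfFinAddOrder (Q - n • P)) →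
          (∀ x : integralH1 (tateRep W p) p (κ.layerSubgroup 0),
            HasLocPKummerLog W p (layerZeroToTop W p κ (x : H1 (tateRep W p) (κ.layerSubgroup 0))) (φ x)) →
          LinearMap.range φ = Submodule.span ℤ_[p] {((p : ℚ_[p]) ^ v₀)} →
          (padicValNat p (Nat.card (coinvariants p J.H2)) : ℤ) + v₀ =
            padicValNat p (Nat.card (AddCommGroup.primaryComponent W.sha p)) + padicValNat p W.tamagawaProduct +
              2 * (padicLogLocal W p
                (WeierstrassCurve.Affine.Point.map (W' := W.toAffine) (S := ℚ) (Algebra.ofId ℚ ℚ_[p]) P)).valuation := by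
  intro W _ _ p _
  letI : ContinuousSMul ℤ_[p] (W.tateModule p) := TateModule.continuousSMul_padicInt
  intro κ γ hκ hγ I J P φ v₀ hr hp2 hadd hj htors hsha _ hpin hP hφ hv₀
  exact hEC W p κ γ hκ hγ I J P φ v₀ hr hp2 hadd hj htors hsha hpin hP hφ hv₀

/-- **COUNT-EC⁰|CM ⟸ {GZK} + COUNT-H2|CM** (Part 32's `countEC₀_additive_of_gzk_of_countH2` re-keyed by `W.HasCM`): GZK gives
rank one; E11 gives `a` with `v₀ = a + v(log_ω P)`; §2 `katoH2CountAt_iff_padicValNat_add_eq_of_hasCM` (→).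
[cite: Kato2004Asterisque, (14.9.3) (p. 240), §14.14 (14.14.1)–(14.14.2) (p. 243), Lemma 14.15 and Prop. 14.16 (p. 244)]
[cite: BlochKato1990, Ex. 3.11] [cite: GrossZagier1986, Thm. I.7.3] [cite: SilvermanATAEC1994, proof of Thm. II.10.5 (p. 172)] -/
theorem countEC₀_cm_of_gzk_of_countH2_cm (hGZK : rank_eq_analyticRank_of_analyticRank_le_one)
    (hH2 : ∀ (W : WeierstrassCurve ℚ) [W.IsElliptic] [W.IsGloballyMinimal] (p : ℕ) [Fact p.Prime],
      letI : ContinuousSMul ℤ_[p] (W.tateModule p) := TateModule.continuousSMul_padicInt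
      ∀ (κ : ZpExtension ℚ p) (γ : absoluteGaloisGroup ℚ), κ.IsCyclotomic → κ.IsTopGenerator γ →
        ∀ (I : IwasawaH1Data W p κ γ) (J : IwasawaH2Data W p κ γ I),
          W.analyticRank = 1 → p ≠ 2 → Addv W p → 0 ≤ padicValRat p W.j → ¬ p ∣ W.torsionOrder → Finite W.sha →
          W.HasCM →
          (∀ (Y : W.FineSelmerDualData κ γ⁻¹) (𝔮 : PrimeSpectrum (IwasawaAlgebra p)), 𝔮.asIdeal.height = 1 →
            Module.lengthAt (IwasawaAlgebra p) J.H2 𝔮 = Module.lengthAt (IwasawaAlgebra p) Y.X 𝔮) →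
          KatoH2CountAt W p (Nat.card (coinvariants p J.H2))) :
    ∀ (W : WeierstrassCurve ℚ) [W.IsElliptic] [W.IsGloballyMinimal] (p : ℕ) [Fact p.Prime],
      letI : ContinuousSMul ℤ_[p] (W.tateModule p) := TateModule.continuousSMul_padicInt
      ∀ (κ : ZpExtension ℚ p) (γ : absoluteGaloisGroup ℚ), κ.IsCyclotomic → κ.IsTopGenerator γ →
        ∀ (I : IwasawaH1Data W p κ γ) (J : IwasawaH2Data W p κ γ I) (P : W.toAffine.Point)
          (φ : integralH1 (tateRep W p) p (κ.layerSubgroup 0) →ₗ[ℤ_[p]] ℚ_[p]) (v₀ : ℤ),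
          W.analyticRank = 1 → p ≠ 2 → Addv W p → 0 ≤ padicValRat p W.j → ¬ p ∣ W.torsionOrder →
          Finite W.sha →
          W.HasCM →
          (∀ (Y : W.FineSelmerDualData κ γ⁻¹) (𝔮 : PrimeSpectrum (IwasawaAlgebra p)), 𝔮.asIdeal.height = 1 →
            Module.lengthAt (IwasawaAlgebra p) J.H2 𝔮 = Module.lengthAt (IwasawaAlgebra p) Y.X 𝔮) →
          (∀ Q : W.toAffine.Point, ∃ n : ℤ, IsOfFinAddOrder (Q - n • P)) →
          (∀ x : integralH1 (tateRep W p) p (κ.layerSubgroup 0),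
            HasLocPKummerLog W p (layerZeroToTop W p κ (x : H1 (tateRep W p) (κ.layerSubgroup 0))) (φ x)) →
          LinearMap.range φ = Submodule.span ℤ_[p] {((p : ℚ_[p]) ^ v₀)} →
          (padicValNat p (Nat.card (coinvariants p J.H2)) : ℤ) + v₀ =
            padicValNat p (Nat.card (AddCommGroup.primaryComponent W.sha p)) + padicValNat p W.tamagawaProduct +
              2 * (padicLogLocal W p
                (WeierstrassCurve.Affine.Point.map (W' := W.toAffine) (S := ℚ) (Algebra.ofId ℚ ℚ_[p]) P)).valuation := by
  intro W _ _ p _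
  letI : ContinuousSMul ℤ_[p] (W.tateModule p) := TateModule.continuousSMul_padicInt
  intro κ γ hκ hγ I J P φ v₀ hr hp2 hadd hj htors hsha hCM hpin hP hφ hv₀
  obtain ⟨hmw, -⟩ := hGZK W (by rw [hr])
  have hrank : W.mordellWeilRank = 1 := by rw [hmw, hr]
  haveI := hsha
  have hsha' : Finite (AddCommGroup.primaryComponent W.sha p) := inferInstance
  obtain ⟨x, hx⟩ := exists_forall_ofTopSubgroup_reduceH1Pk_eq_kummerMapTorsion W p (zsmul_pow_surjective W p) P
  obtain ⟨a, ha, hv₀a⟩ := exists_integralH1_eq_span_pow_smul_and_eq_add_valuation W p κ hrank hsha' htors hP hx φ hφ hv₀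
  have h := padicValNat_add_eq_of_katoH2CountAt_of_hasCM W p hCM hp2 hadd hrank hsha' htors hP hx ha
    (hH2 W p κ γ hκ hγ I J hr hp2 hadd hj htors hsha hCM hpin)
  rw [hv₀a]
  linarith

/-- **COUNT-H2|CM ⟸ {GZK, `Kato2004.thm12_4`} + COUNT-EC⁰|CM** (Part 32's `countH2_of_gzk_of_thm12_4_of_countEC₀` re-keyed by
`W.HasCM` on BOTH sides): on a row `thm12_4` makes `I.H` f.g. torsion-free of rank one, so `(J.H2)_Γ` is finite of `p`-power
order; `φ` with `im φ = p^{v₀} ℤ_p` exists (`exists_kummerLog_range_eq`), rank one gives a generator `P` modulo torsion, E11 gives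
`a` with `v₀ = a + v(log_ω P)`; COUNT-EC⁰|CM at `(P, φ, v₀)` and §2 (←).  Hence, modulo {GZK, `thm12_4`}, COUNT-H2|CM and
COUNT-EC⁰|CM are EQUIVALENT. [cite: Kato2004Asterisque, Thm. 12.4 (p. 221), (14.9.3) (p. 240), §14.14 (p. 243), Lemma 14.15 and
Prop. 14.16 (p. 244)] [cite: BlochKato1990, Ex. 3.11] [cite: SilvermanATAEC1994, proof of Thm. II.10.5 (p. 172)] -/
theorem countH2_cm_of_gzk_of_thm12_4_of_countEC₀_cm (hGZK : rank_eq_analyticRank_of_analyticRank_le_one)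
    (h12 : Kato2004.thm12_4)
    (hEC : ∀ (W : WeierstrassCurve ℚ) [W.IsElliptic] [W.IsGloballyMinimal] (p : ℕ) [Fact p.Prime],
      letI : ContinuousSMul ℤ_[p] (W.tateModule p) := TateModule.continuousSMul_padicInt
      ∀ (κ : ZpExtension ℚ p) (γ : absoluteGaloisGroup ℚ), κ.IsCyclotomic → κ.IsTopGenerator γ →
        ∀ (I : IwasawaH1Data W p κ γ) (J : IwasawaH2Data W p κ γ I) (P : W.toAffine.Point)
          (φ : integralH1 (tateRep W p) p (κ.layerSubgroup 0) →ₗ[ℤ_[p]] ℚ_[p]) (v₀ : ℤ),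
          W.analyticRank = 1 → p ≠ 2 → Addv W p → 0 ≤ padicValRat p W.j → ¬ p ∣ W.torsionOrder →
          Finite W.sha →
          W.HasCM →
          (∀ (Y : W.FineSelmerDualData κ γ⁻¹) (𝔮 : PrimeSpectrum (IwasawaAlgebra p)), 𝔮.asIdeal.height = 1 →
            Module.lengthAt (IwasawaAlgebra p) J.H2 𝔮 = Module.lengthAt (IwasawaAlgebra p) Y.X 𝔮) →
          (∀ Q : W.toAffine.Point, ∃ n : ℤ, IsOfFinAddOrder (Q - n • P)) →
          (∀ x : integralH1 (tateRep W p) p (κ.layerSubgroup 0),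
            HasLocPKummerLog W p (layerZeroToTop W p κ (x : H1 (tateRep W p) (κ.layerSubgroup 0))) (φ x)) →
          LinearMap.range φ = Submodule.span ℤ_[p] {((p : ℚ_[p]) ^ v₀)} →
          (padicValNat p (Nat.card (coinvariants p J.H2)) : ℤ) + v₀ =
            padicValNat p (Nat.card (AddCommGroup.primaryComponent W.sha p)) + padicValNat p W.tamagawaProduct +
              2 * (padicLogLocal W p
                (WeierstrassCurve.Affine.Point.map (W' := W.toAffine) (S := ℚ) (Algebra.ofId ℚ ℚ_[p]) P)).valuation) :
    ∀ (W : WeierstrassCurve ℚ) [W.IsElliptic] [W.IsGloballyMinimal] (p : ℕ) [Fact p.Prime],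
      letI : ContinuousSMul ℤ_[p] (W.tateModule p) := TateModule.continuousSMul_padicInt
      ∀ (κ : ZpExtension ℚ p) (γ : absoluteGaloisGroup ℚ), κ.IsCyclotomic → κ.IsTopGenerator γ →
        ∀ (I : IwasawaH1Data W p κ γ) (J : IwasawaH2Data W p κ γ I),
          W.analyticRank = 1 → p ≠ 2 → Addv W p → 0 ≤ padicValRat p W.j → ¬ p ∣ W.torsionOrder → Finite W.sha →
          W.HasCM →
          (∀ (Y : W.FineSelmerDualData κ γ⁻¹) (𝔮 : PrimeSpectrum (IwasawaAlgebra p)), 𝔮.asIdeal.height = 1 →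
            Module.lengthAt (IwasawaAlgebra p) J.H2 𝔮 = Module.lengthAt (IwasawaAlgebra p) Y.X 𝔮) →
          KatoH2CountAt W p (Nat.card (coinvariants p J.H2)) := by
  intro W _ _ p _
  letI : ContinuousSMul ℤ_[p] (W.tateModule p) := TateModule.continuousSMul_padicInt
  intro κ γ hκ hγ I J hr hp2 hadd hj htors hsha hCM hpin
  obtain ⟨hmw, -⟩ := hGZK W (by rw [hr])
  have hrank : W.mordellWeilRank = 1 := by rw [hmw, hr]
  haveI := hsha
  have hsha' : Finite (AddCommGroup.primaryComponent W.sha p) := inferInstance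
  obtain ⟨hfg, ⟨htf, hrk⟩, -⟩ := h12 W p κ γ hκ hγ I
  haveI := hfg
  haveI := htf
  haveI : Nontrivial I.H := by
    by_contra hnt
    rw [not_nontrivial_iff_subsingleton] at hnt
    have h0 : Module.rank (IwasawaAlgebra p) I.H = 0 := rank_subsingleton' _ _
    rw [hrk] at h0
    exact one_ne_zero h0
  haveI := finite_coinvariants_H2_of_iwasawaH2Data W p J hrank hsha'
  -- a generator modulo torsion, its Kummer class, the functional `φ` and the lattice exponent `a`
  obtain ⟨P, hP₀⟩ := exists_generates_modTorsion_of_mordellWeilRank_eq_one W hrank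
  -- (Part 32 §1's generator lemma carries the classical `DecidableEq` on `W(ℚ)`; `convert` re-bases it on the `ℚ` instance)
  have hP : ∀ Q : W.toAffine.Point, ∃ n : ℤ, IsOfFinAddOrder (Q - n • P) := fun Q => by
    obtain ⟨n, hn⟩ := hP₀ Q
    exact ⟨n, by convert hn⟩
  obtain ⟨x, hx⟩ := exists_forall_ofTopSubgroup_reduceH1Pk_eq_kummerMapTorsion W p (zsmul_pow_surjective W p) P
  obtain ⟨φ, v₀, hφ, -, -, -, hv₀⟩ := exists_kummerLog_range_eq W p J hrank hsha'
  obtain ⟨a, ha, hv₀a⟩ := exists_integralH1_eq_span_pow_smul_and_eq_add_valuation W p κ hrank hsha' htors hP hx φ hφ hv₀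
  have hec := hEC W p κ γ hκ hγ I J P φ v₀ hr hp2 hadd hj htors hsha hCM hpin hP hφ hv₀
  rw [hv₀a] at hec
  exact (katoH2CountAt_iff_padicValNat_add_eq_of_hasCM W p hCM hp2 hadd hrank hsha' htors hP hx ha
    (exists_natCard_eq_pow_of_module p (R := IwasawaAlgebra p) (M := coinvariants p J.H2))).mpr (by linarith)

/-- **COUNT-H2|CM ⟸ {GZK, `Kato2004.thm12_4`} + COUNT-EC⁰** (E9's display verbatim, the companion of the display of record
COUNT-FINE⁰): `countEC₀_cm_of_countEC₀` then `countH2_cm_of_gzk_of_thm12_4_of_countEC₀_cm` (equivalently Part 32's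
`countH2_of_gzk_of_thm12_4_of_countEC₀` then `countH2_cm_of_countH2_additive`).
[cite: Kato2004Asterisque, Thm. 12.4 (p. 221), (14.9.3) (p. 240), §14.14 (p. 243), Prop. 14.16 (p. 244)] -/
theorem countH2_cm_of_gzk_of_thm12_4_of_countEC₀ (hGZK : rank_eq_analyticRank_of_analyticRank_le_one)
    (h12 : Kato2004.thm12_4)
    (hEC : ∀ (W : WeierstrassCurve ℚ) [W.IsElliptic] [W.IsGloballyMinimal] (p : ℕ) [Fact p.Prime],
      letI : ContinuousSMul ℤ_[p] (W.tateModule p) := TateModule.continuousSMul_padicInt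
      ∀ (κ : ZpExtension ℚ p) (γ : absoluteGaloisGroup ℚ), κ.IsCyclotomic → κ.IsTopGenerator γ →
        ∀ (I : IwasawaH1Data W p κ γ) (J : IwasawaH2Data W p κ γ I) (P : W.toAffine.Point)
          (φ : integralH1 (tateRep W p) p (κ.layerSubgroup 0) →ₗ[ℤ_[p]] ℚ_[p]) (v₀ : ℤ),
          W.analyticRank = 1 → p ≠ 2 → Addv W p → 0 ≤ padicValRat p W.j → ¬ p ∣ W.torsionOrder →
          Finite W.sha →
          (∀ (Y : W.FineSelmerDualData κ γ⁻¹) (𝔮 : PrimeSpectrum (IwasawaAlgebra p)), 𝔮.asIdeal.height = 1 →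
            Module.lengthAt (IwasawaAlgebra p) J.H2 𝔮 = Module.lengthAt (IwasawaAlgebra p) Y.X 𝔮) →
          (∀ Q : W.toAffine.Point, ∃ n : ℤ, IsOfFinAddOrder (Q - n • P)) →
          (∀ x : integralH1 (tateRep W p) p (κ.layerSubgroup 0),
            HasLocPKummerLog W p (layerZeroToTop W p κ (x : H1 (tateRep W p) (κ.layerSubgroup 0))) (φ x)) →
          LinearMap.range φ = Submodule.span ℤ_[p] {((p : ℚ_[p]) ^ v₀)} →
          (padicValNat p (Nat.card (coinvariants p J.H2)) : ℤ) + v₀ =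
            padicValNat p (Nat.card (AddCommGroup.primaryComponent W.sha p)) + padicValNat p W.tamagawaProduct +
              2 * (padicLogLocal W p
                (WeierstrassCurve.Affine.Point.map (W' := W.toAffine) (S := ℚ) (Algebra.ofId ℚ ℚ_[p]) P)).valuation) :
    ∀ (W : WeierstrassCurve ℚ) [W.IsElliptic] [W.IsGloballyMinimal] (p : ℕ) [Fact p.Prime],
      letI : ContinuousSMul ℤ_[p] (W.tateModule p) := TateModule.continuousSMul_padicInt
      ∀ (κ : ZpExtension ℚ p) (γ : absoluteGaloisGroup ℚ), κ.IsCyclotomic → κ.IsTopGenerator γ →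
        ∀ (I : IwasawaH1Data W p κ γ) (J : IwasawaH2Data W p κ γ I),
          W.analyticRank = 1 → p ≠ 2 → Addv W p → 0 ≤ padicValRat p W.j → ¬ p ∣ W.torsionOrder → Finite W.sha →
          W.HasCM →
          (∀ (Y : W.FineSelmerDualData κ γ⁻¹) (𝔮 : PrimeSpectrum (IwasawaAlgebra p)), 𝔮.asIdeal.height = 1 →
            Module.lengthAt (IwasawaAlgebra p) J.H2 𝔮 = Module.lengthAt (IwasawaAlgebra p) Y.X 𝔮) →
          KatoH2CountAt W p (Nat.card (coinvariants p J.H2)) :=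
  countH2_cm_of_gzk_of_thm12_4_of_countEC₀_cm hGZK h12 (countEC₀_cm_of_countEC₀ hEC)

end Displays

end Summit.BirchSwinnertonDyer.Rank1Residual.Additive.StrictCount

end
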